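import Summits.ABC.IUTFork.DAGC312v
import Summits.ABC.IUTFork.DAGC312zc

/-!
# Kernel DAG index — layer C312, part zf: the SIDE-A one-name census refreshed after Δ16 (for Team A's 11:30Z line)

index v1 · abc-iut-c312-2 (filer, gen 4). PROOF-ONLY (no definition), APPEND-ONLY. CO-IMPORT SIDE A of the cell's breaker F1 (imports part v,
hence part p / Cor312TeamAChain) — the NEUTRAL one-name census is `cor312_kernel_census_v10` (part ze); cite THIS one only from side-A
or neutral files.

THIS FILE PROVES NOTHING NEW AND ASSERTS NOTHING. Part v's `cor312_kernel_census` (p421447) carried clause 1 (LOCI) with the free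
hypothesis `pending .SHE`; Δ16 (part zc, p428234) knitted (SHE) to abc-iut-c312-1's typed reading, so the refreshed census says, BY NAME:
(A1) Theorem 3.11 as typed + (IPL) grant ALL 85 loci with (SHE) at its typed reading (`lociReadingJ_all`) and the (xi-f) observation is
derivable in the least reading (`derivable_xi_f_of_statement_of_ipl`) — no opaque locus, no free parameter consulted; (A2) everything
part v records at an ARBITRARY `pending` (steps ⟺ Statement under the side data; the one node ⟺ Statement ⟺ GapGlobal ⟺ SoundAtPilot;
independence of `pending`; readings; non-vacuity / non-automaticity over typed-Thm-3.11 instances). No side taken on [IUTchIII] Cor. 3.12;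
typed ≠ discharged; indexed ≠ endorsed. [claim: Mochizuki2012, status: disputed]
-/

noncomputable section

namespace Summit.ABC.IUTFork.DAG

open Cor312Proof Thm311 Cor312Vol InputStrip Literature.IUT.LogThetaLattice PartC312k

/-- **SIDE-A ONE-NAME CENSUS v11** = (A1) Δ16's all-loci / least-reading clauses with (SHE) TYPED ∧ (A2) part v's census at the given
`pending`. Cite as `Summit.ABC.IUTFork.DAG.cor312_kernel_census_v11`; neutral twin: `cor312_kernel_census_v10`. [claim: Mochizuki2012, status: disputed] -/
theorem cor312_kernel_census_v11 {T : ThetaIndex} (S : FullSituation T) (pending : Locus → Prop) (P : Cor312.Setting S.toSituation)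
    (D : ThetaLinkStrips P.LogLink P.Strip) :
    -- (A1) loci with (SHE) typed: no hypothesis beyond Thm 3.11 as typed + (IPL)
    ((S.Statement → S.link.IPL → ∀ c, lociReadingI S (fun _ => S.SHETyped) c) ∧
      (S.Statement → S.link.IPL → Derivable (lociReadingI S (fun _ => S.SHETyped)) .constitutesConstruction)) ∧
    -- (A2) part v's census, by name
    StatementOf (cor312_kernel_census S pending P D) :=
  ⟨⟨fun hS hI => lociReadingJ_all S hS hI, fun hS hI => derivable_xi_f_of_statement_of_ipl S hS hI⟩, cor312_kernel_census S pending P D⟩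

end Summit.ABC.IUTFork.DAG

end
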